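import Summits.ResolutionOfSingularities.ResolutionOfSingularities.Theorems.HomologicalConductorSurfaceTerminationGenusDescentDoor
import Summits.ResolutionOfSingularities.ResolutionOfSingularities.Theorems.HomologicalConductorSurfaceTerminationCaptureDescent
import Summits.ResolutionOfSingularities.ResolutionOfSingularities.Theorems.HomologicalConductorSurfaceTerminationRationalDescentFourFacts
import Summits.ResolutionOfSingularities.ResolutionOfSingularities.Theorems.HomologicalConductorSurfaceTerminationReductionFourFacts
import Summits.ResolutionOfSingularities.ResolutionOfSingularities.Theorems.HomologicalConductorNoZenoRLipman12B
import HarnessLib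

/-!
# Kill test `SurfaceTermination` (stmt-ResolutionOfSingularities-16488): the doors with the EXACT print debt —
# Lipman (1.2) discharged (hand 18), (12.1)(i) not needed

Route `ResolutionOfSingularities/HomologicalConductor`.  OURS (hand leafhand-res-homologicalconduct-20, 2026-08-31);
nothing here is a statement of the manuscript under review (Hironaka 2017); AI-written, weaker than expert review.

The doors `GenusDescentDoor.surfaceTermination_of_facts_of_initialPair` (p831217) and
`CaptureDescent.surfaceTermination_of_facts_of_nonrationalCapture` (p831096) carry the line's registered SIX-fact
binder.  Of those six, `Lipman1969_1_2.{0}` is now a THEOREM (`NoZeno.Lipman12B.Lipman1969_1_2_holds`, hand 18,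
p828157/…) and `Lipman1969_12_1_i` is not used by the four-print twins of the reduction and of (R2)
(`Reduction.FourFacts.surfaceTermination_of_primeDivisorCase_of_facts4`,
`Descent.FourFacts.rationalStageTermination4`, `RationalDescent.FourFacts.isPrincipal_map_ca_of_isRegularLocalRing_dominating4`,
hand 3).  Re-running the two compositions over the twins gives the doors with the exact remaining print debt:

* **`surfaceTermination_of_prints_of_initialPair`** — `CossartJannsenSaito2020General`, `Lipman1969_4_1`,
  `Lipman1969_12_1_ii`, `GortzWedhorn2023_24_44_H2` (FOUR prints; Görtz–Wedhorn enters only through `p_g`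
  non-increase) + the (E)-form residue in UNCONDITIONAL form (no fact binder) ⇒ `SurfaceTermination` BY NAME.
* **`surfaceTermination_of_prints_of_nonrationalCapture`** — `CossartJannsenSaito2020General`, `Lipman1969_4_1`,
  `Lipman1969_12_1_ii` (THREE prints; no genus bookkeeping at all) + (CAP¬rat) ⇒ `SurfaceTermination` BY NAME.

No new definitions.  Named-fact hypotheses explicit, as listed.

References: J. Lipman, Publ. Math. IHÉS 36 (1969), (1.2), (4.1), (12.1) [`Lipman1969`]; V. Cossart, U. Jannsen,
S. Saito (2020), Thm. 1.2 [`CossartJannsenSaito2020`]; U. Görtz, T. Wedhorn, AG II (2023), Thm. 24.44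
[`GortzWedhorn2023`]; O. Zariski, P. Samuel, *Commutative Algebra* II, Ch. VI §14, §17 [`ZariskiSamuel1960`].
-/

set_option linter.dupNamespace false

noncomputable section

namespace Summit.ResolutionOfSingularities.ResolutionOfSingularities.Theorems.SurfaceTermination.PrintDebtDoors

open Summit.ResolutionOfSingularities.ResolutionOfSingularities.Theses.HomologicalConductor (SurfaceTermination)
open Summit.ResolutionOfSingularities.ResolutionOfSingularities.Theorems
open Summit.ResolutionOfSingularities.ResolutionOfSingularities.Theorems.NoZeno.Birth
open Summit.ResolutionOfSingularities.ResolutionOfSingularities.Theorems.NoZeno.SandwichCluster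
open Summit.ResolutionOfSingularities.ResolutionOfSingularities.Theorems.SurfaceTermination.GenusDescent
open Summit.ResolutionOfSingularities.ResolutionOfSingularities.Theorems.SurfaceTermination.GenusDescentDoor
open Summit.ResolutionOfSingularities.ResolutionOfSingularities.Theorems.SurfaceTermination.Descent
open Summit.ResolutionOfSingularities.ResolutionOfSingularities.Theorems.SurfaceTermination.CaptureDescent
open Literature.AlgebraicGeometry.Resolution Literature.AlgebraicGeometry.Morphisms Polynomial
open Literature.RingTheory.CohomologyAnnihilator (cohomologyAnnihilator)
open CategoryTheory AlgebraicGeometry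

/-- **FOUR prints + the unconditional (E)-form residue ⇒ `SurfaceTermination` BY NAME.**  Prints: CJS 2020 Thm 1.2
(resolution of the stages), Lipman (4.1) and (12.1)(ii) (THEOREM A / (R2) at rational stages), Görtz–Wedhorn
24.44 H² (`p_g` non-increase); Lipman (1.2) is supplied by the tree theorem `Lipman1969_1_2_holds`.  Residue: along
a prime divisor, an eternal positive constant geometric genus yields an initial pair (the line's stub 5 WITHOUT its
fact binder).  Proof = the genus descent of `GenusDescentDoor` over the four-print twins: `p_g(T₁) < ∞`
(`exists_hasGeometricGenusLE_tower_succ`, CJS), non-increase (`hasGeometricGenusLE_tower_succ_succ`), no eternal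
positive constant genus (initial pair ⇒ regular stage ⇒ rational ⇒ genus 0), a genus-0 stage is rational and (R2)
`rationalStageTermination4` ends the tower; then `surfaceTermination_of_primeDivisorCase_of_facts4`.
[cite: Lipman1969, Proposition (1.2) and Theorem (4.1) (pp. 199, 204)] [cite: CossartJannsenSaito2020, Thm. 1.2] -/
theorem surfaceTermination_of_prints_of_initialPair
    (hCJS : CossartJannsenSaito2020General.{0}) (h41 : Lipman1969_4_1.{0}) (h12ii : Lipman1969_12_1_ii.{0})
    (hGW : GortzWedhorn2023_24_44_H2.{0})
    (hPair : ∀ p : ℕ, p.Prime → ∀ (k K : Type) [Field k] [CharP k p] [Field K] [Algebra k K]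
      (O : ValuationSubring K) (A : Subalgebra k K) (hk : ∀ c : k, algebraMap k K c ∈ O), A.FG →
      IsFractionRing ↥A K → A.toSubring ≤ O.toSubring → ringKrullDim ↥A = 2 →
      O ≠ ⊤ → IsDiscreteValuationRing ↥O → residueTrdeg k O hk + 1 = Algebra.trdeg k K →
      ∀ g m : ℕ, (∀ m' : ℕ, m ≤ m' →
        HasGeometricGenusLE ↥(tower O A (m' + 1)) (g + 1) ∧ ¬ HasGeometricGenusLE ↥(tower O A (m' + 1)) g) →
        ∃ (m' : ℕ) (g₀ g₁ : K), g₀ ∈ ca (tower O A m') ∧ g₁ ∈ ca (tower O A m') ∧ g₀ ≠ 0 ∧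
          (∀ c ∈ ca (tower O A m'), c * g₀⁻¹ ∈ O) ∧
          ∀ f : k[X], f ≠ 0 → ¬ O.valuation (aeval (g₁ * g₀⁻¹) f) < 1) :
    SurfaceTermination := by
  have h12 : Lipman1969_1_2.{0} := NoZeno.Lipman12B.Lipman1969_1_2_holds
  have hF4 : (CossartJannsenSaito2020General.{0} ∧ Lipman1969_1_2.{0} ∧ Lipman1969_4_1.{0} ∧
      Lipman1969_12_1_ii.{0}) := ⟨hCJS, h12, h41, h12ii⟩
  refine Reduction.FourFacts.surfaceTermination_of_primeDivisorCase_of_facts4 hF4 ?_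
  intro p hp k K _ _ _ _ O A hk hA hfr hAO hdim hOtop hdvr hres
  show ∃ m : ℕ, IsRegularLocalRing ↥(tower O A m)
  haveI := hfr
  have htr : Algebra.trdeg k K = 2 := trdeg_eq_two_of_ringKrullDim A hA hfr hdim
  -- no eternal positive constant genus: an initial pair gives a regular, hence rational, hence genus-0 stage
  have hDrop : ∀ g m : ℕ, (∀ m' : ℕ, m ≤ m' →
      HasGeometricGenusLE ↥(tower O A (m' + 1)) (g + 1) ∧ ¬ HasGeometricGenusLE ↥(tower O A (m' + 1)) g) →
      False := by
    intro g m h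
    obtain ⟨m', g₀, g₁, hg₀, hg₁, hg₀0, hmin, hval⟩ := hPair p hp k K O A hk hA hfr hAO hdim hOtop hdvr hres g m h
    obtain ⟨m'', hreg⟩ := exists_regular_of_initialPair p hp k K O A hk hA hfr hAO hdim m' hg₀ hg₁ hg₀0 hmin hval
    have hreg' : IsRegularLocalRing ↥(tower O A (m'' + m + 1)) :=
      isRegularLocalRing_tower_of_le O A hk hfr hAO (by omega) hreg
    have hrat : HasRationalSingularity ↥(tower O A (m'' + m + 1)) := by
      haveI := hreg'
      exact hasRationalSingularity_of_isRegularLocalRing _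
    exact (h (m'' + m) (Nat.le_add_left m m'')).2
      (hasGeometricGenusLE_mono (Nat.zero_le g) ((hasGeometricGenusLE_zero_iff _).mpr hrat))
  obtain ⟨g, hg⟩ := exists_hasGeometricGenusLE_tower_succ hCJS p hp k K O A hk hA hfr hAO htr 0
  obtain ⟨m₁, hm₁⟩ := exists_genusZero_stage (fun n => tower O A (n + 1))
    (fun g m h => hasGeometricGenusLE_tower_succ_succ hCJS h12 hGW O A hk hA hfr hAO htr m g h) hDrop g 0 hg
  exact Descent.FourFacts.rationalStageTermination4 hF4 p hp k K O A hk hA hfr hAO hdim m₁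
    (hasRationalSingularity_of_genusLE_zero hm₁)

/-- **THREE prints + (CAP¬rat) ⇒ `SurfaceTermination` BY NAME.**  Prints: CJS 2020 Thm 1.2, Lipman (4.1),
(12.1)(ii); Lipman (1.2) from the tree.  Hypothesis (CAP¬rat): at every singular NON-rational stage `T_(m+1)` of
every tower, `ca(T_(m+1))·S` is principal for every regular local `k`-subalgebra `S ⊇ T_(m+1)` of `K`, essentially
of finite type and dominating it.  Proof: `T_1` regular, or singular with a CJS resolution and the fact-free
E-descent `termination_of_capture` from `m₁ = 0`, capture being the four-print THEOREM A
(`isPrincipal_map_ca_of_isRegularLocalRing_dominating4`) at rational stages and (CAP¬rat) elsewhere — no genus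
bookkeeping, so Görtz–Wedhorn is not needed. [cite: CossartJannsenSaito2020, Thm. 1.2]
[cite: Lipman1969, Theorem (4.1) (p. 204)] -/
theorem surfaceTermination_of_prints_of_nonrationalCapture
    (hCJS : CossartJannsenSaito2020General.{0}) (h41 : Lipman1969_4_1.{0}) (h12ii : Lipman1969_12_1_ii.{0})
    (hCAP : ∀ (k K : Type) [Field k] [Field K] [Algebra k K] (O : ValuationSubring K) (A : Subalgebra k K),
      (∀ c : k, algebraMap k K c ∈ O) → A.FG → IsFractionRing ↥A K → A.toSubring ≤ O.toSubring →
      ringKrullDim ↥A = 2 → ∀ m : ℕ, ¬ IsRegularLocalRing ↥(tower O A (m + 1)) →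
      ¬ HasRationalSingularity ↥(tower O A (m + 1)) →
      ∀ (S : Subalgebra k K) (hTS : tower O A (m + 1) ≤ S),
        (∀ t ∈ tower O A (m + 1), t⁻¹ ∈ S → t⁻¹ ∈ tower O A (m + 1)) →
        IsRegularLocalRing ↥S → Algebra.EssFiniteType k ↥S →
        (Ideal.map (Subalgebra.inclusion hTS).toRingHom
          (cohomologyAnnihilator ↥(tower O A (m + 1)))).IsPrincipal) :
    SurfaceTermination := by
  have h12 : Lipman1969_1_2.{0} := NoZeno.Lipman12B.Lipman1969_1_2_holds
  have hF4 : (CossartJannsenSaito2020General.{0} ∧ Lipman1969_1_2.{0} ∧ Lipman1969_4_1.{0} ∧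
      Lipman1969_12_1_ii.{0}) := ⟨hCJS, h12, h41, h12ii⟩
  intro p _hp k K _ _ _ _ O A hk hA hfr hAO hdimA ca' loc chart nrm tower'
  show ∃ m : ℕ, IsRegularLocalRing ↥(NoZeno.Birth.tower O A m)
  by_cases hreg₁ : IsRegularLocalRing ↥(NoZeno.Birth.tower O A (0 + 1))
  · exact ⟨_, hreg₁⟩
  haveI := hfr
  have htr : Algebra.trdeg k K = 2 := trdeg_eq_two_of_ringKrullDim A hA hfr hdimA
  haveI : IsNoetherianRing ↥(NoZeno.Birth.tower O A (0 + 1)) := stub_towerNoetherian k K O A hk hA hfr hAO _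
  haveI : IsIntegrallyClosed ↥(NoZeno.Birth.tower O A (0 + 1)) :=
    d2rc_isIntegrallyClosed_tower_succ O A hk hA hfr hAO 0
  haveI : IsLocalRing ↥(NoZeno.Birth.tower O A (0 + 1)) := by
    obtain ⟨B, hBO, hTB⟩ := exists_tower_eq_loc O A hk hAO (0 + 1)
    rw [hTB, loc_eq_locAt]; exact SyzygyFlattening.isLocalRing_locAt O B hBO
  have hET : Algebra.EssFiniteType k ↥(NoZeno.Birth.tower O A (0 + 1)) :=
    (tn_tower_invariant O A hk hA hfr hAO (0 + 1)).2.2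
  have hdimT : ringKrullDim ↥(NoZeno.Birth.tower O A (0 + 1)) = 2 :=
    ringKrullDim_tower_eq_two_of_not_isRegularLocalRing O A hk hA hfr hAO htr 0 hreg₁
  obtain ⟨X, π, hπ⟩ :=
    exists_isResolution_Spec_of_cjsGeneral hCJS k ↥(NoZeno.Birth.tower O A (0 + 1)) hET hdimT.le
  refine termination_of_capture O A hk hA hfr hAO hdimA 0 hreg₁ ⟨X, π, hπ⟩ ?_
  intro i hi hsingi S hTS hdomS hSreg hSeft
  obtain ⟨d, rfl⟩ : ∃ d, i = d + 1 := ⟨i - 1, by omega⟩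
  by_cases hrat : HasRationalSingularity ↥(NoZeno.Birth.tower O A (d + 1))
  · exact RationalDescent.FourFacts.isPrincipal_map_ca_of_isRegularLocalRing_dominating4 hF4 O A hk hA hfr hAO
      htr d hsingi hrat S hTS hdomS hSreg hSeft
  · exact hCAP k K O A hk hA hfr hAO hdimA d hsingi hrat S hTS hdomS hSreg hSeft

end Summit.ResolutionOfSingularities.ResolutionOfSingularities.Theorems.SurfaceTermination.PrintDebtDoors

end
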